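import Summits.QuantumFields.YangMills.Theorems.LuscherReductionTwistedTraceScalingInnerOfSoftTube
import Summits.QuantumFields.YangMills.Theorems.LuscherReductionTwistedTraceScalingInnerBOPackage
import HarnessLib

/-!
# The Born–Oppenheimer (Feshbach) PACKAGE in TUBE CURRENCY and ★★★ `SoftTubeNoIntruderAt L χ ⇐ SoftTubeBOPackageAt L χ`
# (lane A of S-BASE, crux `TwistedTraceScaling` stmt-QuantumFields-20203, sub-target C4 INNER; design note `pub/ym-fleet/ym-luscher-20007-p1/COARSE-DESIGN.md` §23.5 (f))

`…InnerBOPackage` (g11) typed the Feshbach package for gauge-INVARIANT families with the lattice kernel `K_β` and the `L²(dU)` norm.  After the exact gauge slice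
(`…GaugeSlice`, `…InnerOfSoftTube`) the C4-CORE problem lives on a tube with the gauge-AVERAGED kernel `K̃_β = avgKernel β` and the weighted norm `∫ f²·(N/χ)`
(`softWeight χ`), for ARBITRARY bounded measurable families supported in `supp χ`.  This file restates the package in that currency — same clauses, same real-number
endgame (`feshbach_endgame` of `…InnerBOPackage`):
* `tubeForm β f = ∫∫ f(U) K̃_β(U,V) f(V)`, `tubeNormSq w f = ∫ f² w`;
* `SoftTubeBOPackageAt L χ`: for every `k`, `ε > 0`: a β-independent stiff gap `θ ∈ (0,1]`, eventually a ground value `σ > 0` and off-diagonal size `b` (`b² ≤ εθλ_b/16`) with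
  (FLOOR) `e^{−ελ_b/4}σμ₀(L³β) ≤ λ₀(β,L)`, and every admissible tube family `f₀…f_k` splits `fᵢ = uᵢ + vᵢ` with, for all `a`: masses `0 ≤ ‖u_a‖²_w, ‖v_a‖²_w`,
  `‖u_a‖²_w + ‖v_a‖²_w ≤ ‖f_a‖²_w`, (STIFF) `tubeForm v_a ≤ (1−θ)σμ₀‖v_a‖²_w`, (OFF-DIAG) `tubeForm f_a ≤ tubeForm u_a + 2bσμ₀‖u_a‖_w‖v_a‖_w + tubeForm v_a`, (SLOW) some `a ≠ 0`
  with `tubeForm u_a ≤ e^{ελ_b/4}σμ_k(L³β)‖u_a‖²_w`;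
* ★★★ `softTubeNoIntruderAt_of_package : SoftTubeBOPackageAt L χ → SoftTubeNoIntruderAt L χ`; with `…RecordWeight`:
  C4-CORE(s) ⟸ `SoftTubeBOPackageAt L (recordWeight L (powScale s) (powScale t))` (`innerNoIntruderOneOrbitAt_of_softTube` ∘ this).
The clauses are what §23.5 (f) discharges: `u = P f` the fibrewise projection onto `(one-site profile) ⊗ Ω₀(w) ⊗ e^{−η²/δg²}` in the tube coordinates `(u; w, η)` with
EXACT one-site Haar in `u` (`…SlowDisintegration`), STIFF/OFF-DIAG from the Mehler bricks (`…MehlerTensorGap`, `…InnerModelPerturbedTail`), SLOW/FLOOR from the one-site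
level family forms, σ from the FP normalisation `N` (constant to `o(λ_b)` by the symmetry lemma Y).
HONEST FRAMING: a typed reduction (finite-dimensional Feshbach bookkeeping) for a stub of a child of the CONDITIONAL reduction route R2b1; the package is OPEN; not infinite
volume, not a gap, not Clay.
-/

set_option autoImplicit false

noncomputable section

open MeasureTheory Filter Topology Real
open scoped BigOperators
open Literature.MathematicalPhysics.QuantumFieldTheory
open Literature.MathematicalPhysics.QuantumLattice

namespace Summit.QuantumFields.YangMills.Theorems.FemtoTransferGap

open TwoLattice.Avg

variable {L : ℕ} [NeZero L]

/-! ## §1 Tube currency -/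

/-- The tube form `⟨f, K̃_β f⟩ = ∫∫ f(U) K̃_β(U,V) f(V) dU dV` of the gauge-averaged kernel. [cite: SeilerLNP1982, §3] -/
def tubeForm (β : ℝ) (f : GaugeConfig 3 L SU2 → ℝ) : ℝ :=
  ∫ U, ∫ V, f U * avgKernel β U V * f V ∂configMeasure SU2 L ∂configMeasure SU2 L

/-- The weighted squared norm `∫ f² w`. [folklore] -/
def tubeNormSq (w f : GaugeConfig 3 L SU2 → ℝ) : ℝ := ∫ U, f U ^ 2 * w U ∂configMeasure SU2 L

variable (L) in
/-- **THE BO PACKAGE IN TUBE CURRENCY** (`SoftTubeBOPackageAt L χ`; OPEN — the typed content of the Born–Oppenheimer analysis of the gauge-averaged kernel on the tube).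
Same clauses as `InnerBOPackageAt` with `qform ↦ tubeForm`, `l2 ↦ tubeNormSq (softWeight (χ β))`, gauge invariance and orbit support replaced by support in `supp (χ β)`.
[cite: Luscher1983, §3] [cite: SjostrandZworski2007, §2] -/
def SoftTubeBOPackageAt (χ : ℝ → GaugeConfig 3 L SU2 → ℝ) : Prop :=
  ∀ k : ℕ, ∀ ε : ℝ, 0 < ε → ∃ θ : ℝ, 0 < θ ∧ θ ≤ 1 ∧ ∃ β0 : ℝ, ∀ β : ℝ, β0 ≤ β →
    ∃ σ b : ℝ, 0 < σ ∧ 0 ≤ b ∧ b ^ 2 ≤ ε * θ * bareLambda ((L : ℝ) ^ 3 * β) / 16 ∧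
      Real.exp (-(ε / 4 * bareLambda ((L : ℝ) ^ 3 * β))) * (σ * levelValue su2Rep 1 ((L : ℝ) ^ 3 * β) 0) ≤ levelValue su2Rep L β 0 ∧
      ∀ f : Fin (k + 1) → (GaugeConfig 3 L SU2 → ℝ),
        (∀ i, Measurable (f i)) → (∀ i, ∃ C : ℝ, ∀ U, |f i U| ≤ C) → (∀ i U, f i U ≠ 0 → χ β U ≠ 0) →
        (∀ a : Fin (k + 1) → ℝ, a ≠ 0 → 0 < tubeNormSq (softWeight (χ β)) (fun U => ∑ i, a i * f i U)) →
          ∃ u v : Fin (k + 1) → (GaugeConfig 3 L SU2 → ℝ),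
            (∀ a : Fin (k + 1) → ℝ,
              0 ≤ tubeNormSq (softWeight (χ β)) (fun U => ∑ i, a i * u i U) ∧
              0 ≤ tubeNormSq (softWeight (χ β)) (fun U => ∑ i, a i * v i U) ∧
              tubeNormSq (softWeight (χ β)) (fun U => ∑ i, a i * u i U) + tubeNormSq (softWeight (χ β)) (fun U => ∑ i, a i * v i U) ≤
                tubeNormSq (softWeight (χ β)) (fun U => ∑ i, a i * f i U) ∧
              tubeForm β (fun U => ∑ i, a i * v i U) ≤
                (1 - θ) * (σ * levelValue su2Rep 1 ((L : ℝ) ^ 3 * β) 0) * tubeNormSq (softWeight (χ β)) (fun U => ∑ i, a i * v i U) ∧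
              tubeForm β (fun U => ∑ i, a i * f i U) ≤
                tubeForm β (fun U => ∑ i, a i * u i U) +
                  2 * (b * (σ * levelValue su2Rep 1 ((L : ℝ) ^ 3 * β) 0)) *
                    Real.sqrt (tubeNormSq (softWeight (χ β)) (fun U => ∑ i, a i * u i U)) *
                    Real.sqrt (tubeNormSq (softWeight (χ β)) (fun U => ∑ i, a i * v i U)) +
                  tubeForm β (fun U => ∑ i, a i * v i U)) ∧
            ∃ a : Fin (k + 1) → ℝ, a ≠ 0 ∧
              tubeForm β (fun U => ∑ i, a i * u i U) ≤
                Real.exp (ε / 4 * bareLambda ((L : ℝ) ^ 3 * β)) * (σ * levelValue su2Rep 1 ((L : ℝ) ^ 3 * β) k) *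
                  tubeNormSq (softWeight (χ β)) (fun U => ∑ i, a i * u i U)

/-! ## §2 ★★★ The tube statement from the package -/

/-- ★★★ **SOFT TUBE NO-INTRUDER FROM THE TUBE BO PACKAGE**: `SoftTubeBOPackageAt L χ → SoftTubeNoIntruderAt L χ` (Feshbach endgame of `…InnerBOPackage`, verbatim).
[cite: Luscher1983, §3] [cite: SjostrandZworski2007, §2] -/
theorem softTubeNoIntruderAt_of_package {χ : ℝ → GaugeConfig 3 L SU2 → ℝ} (hP : SoftTubeBOPackageAt L χ) : SoftTubeNoIntruderAt L χ := by
  intro k ε hε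
  have hL1 : (1 : ℝ) ≤ (L : ℝ) ^ 3 := one_le_pow₀ (by exact_mod_cast NeZero.one_le)
  obtain ⟨C1, B0, hONE⟩ := oneSiteLevels_proof k
  obtain ⟨θ, hθ, hθ1, βP, hPk⟩ := hP k ε hε
  set τ : ℝ := θ / (2 * (|levelGap k| + |C1| + 2)) with hτ
  have hτ0 : 0 < τ := by rw [hτ]; positivity
  refine ⟨max (max 1 B0) (max βP (2 / τ ^ 3)), fun β hβ => ?_⟩
  have hβ1 : 1 ≤ β := ((le_max_left _ _).trans (le_max_left _ _)).trans hβ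
  have hβ0 : 0 < β := by linarith
  have hβB0 : B0 ≤ β := ((le_max_right _ _).trans (le_max_left _ _)).trans hβ
  have hβP : βP ≤ β := ((le_max_left _ _).trans (le_max_right _ _)).trans hβ
  have hβτ : 2 / τ ^ 3 ≤ β := ((le_max_right _ _).trans (le_max_right _ _)).trans hβ
  intro f hfm hfb hfs hGram
  have hB'β : β ≤ (L : ℝ) ^ 3 * β := by nlinarith
  have hB'0 : 0 < (L : ℝ) ^ 3 * β := lt_of_lt_of_le hβ0 hB'β
  obtain ⟨hμ0, -, hμk⟩ := hONE ((L : ℝ) ^ 3 * β) (hβB0.trans hB'β)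
  set lam := bareLambda ((L : ℝ) ^ 3 * β) with hlamdef
  have hlam0 : 0 < lam := bareLambda_pos' hB'0
  have hlamτ : lam ≤ τ := bareLambda_cube_le (L := L) hτ0 hβτ
  have hτle : τ ≤ 1 / (2 * (|levelGap k| + |C1| + 2)) := by
    rw [hτ]; exact div_le_div_of_nonneg_right hθ1 (by positivity)
  obtain ⟨-, -, hy⟩ := smallness_of_le hlam0.le (hlamτ.trans hτle)
  have hμk' : Real.exp (-(levelGap k * lam + |C1| * lam ^ 2)) * levelValue su2Rep 1 ((L : ℝ) ^ 3 * β) 0 ≤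
      levelValue su2Rep 1 ((L : ℝ) ^ 3 * β) k := by
    refine le_trans (mul_le_mul_of_nonneg_right (Real.exp_le_exp.2 ?_) hμ0.le) hμk
    have := mul_le_mul_of_nonneg_right (le_abs_self C1) (sq_nonneg lam)
    linarith
  have hμk2 := half_le_of_exp_lower hy hμ0.le hμk'
  have hyθ : levelGap k * lam + |C1| * lam ^ 2 ≤ θ / 2 := by
    have hlam1 : lam ≤ 1 := by
      have : τ ≤ 1 / (2 * 2) := hτle.trans (by
        apply div_le_div_of_nonneg_left (by norm_num) (by norm_num)
        nlinarith [abs_nonneg (levelGap k), abs_nonneg C1])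
      linarith
    have h1 : levelGap k * lam ≤ |levelGap k| * lam := mul_le_mul_of_nonneg_right (le_abs_self _) hlam0.le
    have h2 : |C1| * lam ^ 2 ≤ |C1| * lam := by
      refine mul_le_mul_of_nonneg_left ?_ (abs_nonneg _); nlinarith
    have h3 : (|levelGap k| + |C1|) * lam ≤ (|levelGap k| + |C1|) * τ := mul_le_mul_of_nonneg_left hlamτ (by positivity)
    have h4 : (|levelGap k| + |C1|) * τ ≤ θ / 2 := by
      rw [hτ]
      have hpos : 0 < 2 * (|levelGap k| + |C1| + 2) := by positivity
      rw [mul_div_assoc', div_le_iff₀ hpos]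
      nlinarith [abs_nonneg (levelGap k), abs_nonneg C1]
    linarith
  have hμkθ : (1 - θ / 2) * levelValue su2Rep 1 ((L : ℝ) ^ 3 * β) 0 ≤ levelValue su2Rep 1 ((L : ℝ) ^ 3 * β) k := by
    refine le_trans (mul_le_mul_of_nonneg_right ?_ hμ0.le) hμk'
    have := Real.add_one_le_exp (-(levelGap k * lam + |C1| * lam ^ 2))
    linarith
  obtain ⟨σ, b, hσ, -, hb2, hfloor, hsplit⟩ := hPk β hβP
  obtain ⟨u, v, hall, a, ha, huu⟩ := hsplit f hfm hfb hfs hGram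
  obtain ⟨hNu, hNv, hN, hvv, hQ⟩ := hall a
  refine ⟨a, ha, ?_⟩
  exact feshbach_endgame hε.le hlam0.le hσ.le hθ hμ0.le hμk2 hμkθ hNu hNv hN hb2 hfloor hvv hQ huu

/-- ★★★ **C4 INNER ONE-ORBIT ⇐ the tube BO package for an admissible soft weight.** [cite: Luscher1983, §3] -/
theorem innerNoIntruderOneOrbitAt_of_softTubePackage {δ : ℝ → ℝ} {χ : ℝ → GaugeConfig 3 L SU2 → ℝ} (hT : SoftTubeAdmissible L δ χ)
    (hP : SoftTubeBOPackageAt L χ) : InnerNoIntruderOneOrbitAt L δ :=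
  innerNoIntruderOneOrbitAt_of_softTube hT (softTubeNoIntruderAt_of_package hP)

end Summit.QuantumFields.YangMills.Theorems.FemtoTransferGap

end
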